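import Summits.QuantumAdvantage.QuantumAdvantage.Theses.ArithStatLadder
import Literature.NumberTheory.QuadraticFields.ThreeTorsion
import Literature.NumberTheory.QuadraticFields.ThreeTorsionMeanLocalAtThree
import Literature.NumberTheory.QuadraticFields.ScholzReflection
import Literature.NumberTheory.QuadraticFields.ScholzHeckeUnitCriterion
import Literature.NumberTheory.QuadraticFields.ScholzHeckeUnitCriterionProofs
import Summits.QuantumAdvantage.QuantumAdvantage.Theorems.AvgFaceBeyondPrior.Negative.AvgFaceBeyondPriorNecessary
import Summits.QuantumAdvantage.QuantumAdvantage.Theorems.AvgFaceBeyondPrior.Negative.AvgFaceBeyondPriorBlocks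
import Summits.QuantumAdvantage.QuantumAdvantage.Theorems.ArithStatLadderAvgFaceBeyondPriorHeurTransfer
import Summits.QuantumAdvantage.QuantumAdvantage.Theorems.ArithStatLadderAvgFaceBeyondPriorMirrorRankRare
import Summits.QuantumAdvantage.QuantumAdvantage.Theorems.ArithStatLadderAvgFaceBeyondPriorMirrorUnitData
import Summits.QuantumAdvantage.QuantumAdvantage.Theorems.ArithStatLadderAvgFaceBeyondPriorUnitCubeMemBQP
import Summits.QuantumAdvantage.QuantumAdvantage.Theorems.ArithStatLadderAvgFaceBeyondPriorOracleLangMemBQP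
import Summits.QuantumAdvantage.QuantumAdvantage.Theorems.ArithStatLadderUnitCubeMemBQP
import Summits.QuantumAdvantage.QuantumAdvantage.Theorems.ArithStatLadderMirrorHeurTransfer
import Summits.QuantumAdvantage.QuantumAdvantage.Theorems.ArithStatLadderMirrorAssembly
import Summits.QuantumAdvantage.QuantumAdvantage.Theorems.ArithStatLadderAvgFaceBeyondPriorMirrorTorsionImpThreeDvd
import Literature.NumberTheory.QuadraticFields.ScholzHeckeUnitCriterionHolds
import HarnessLib.Audit

/-!
# Skeleton v7 (lead c2) of line `mirror-unit-signature` for crux `ArithStatLadder.AvgFaceBeyondPrior`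
# (stmt-QuantumAdvantage-2427)

Crux: `AvgFaceBeyondPrior = ((IQ3, U) ∉ Heur_{1/3}BPP)`, `IQ3 = {bin d : −d fundamental, 3 ∣ h(−d)}`,
`U_n` uniform on the n-bit `d` with `−d` fundamental (`Negative.avgFace_iff_Q : crux ↔ Negative.Q ∉ …`, `Iff.rfl`).

## State inherited from leads 0 and c1 (skeletons v3/v4) and what v5 changes

Leads 0/c1 landed every earnable stub of v3 as Theorems files (`Mirror.stub_mirrorUnitData` p85730,
`Mirror.stub_unitCubeMemBQP` p86441, `Mirror.stub_mirrorRankRare` p87687, `Mirror.stub_heurTransfer` p87995,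
`Mirror.stub_oracleLangMemBQP` p91280; route items UnitCubeMemBQP 15005 / MirrorHeurTransfer 15006 /
MirrorAssembly 15007 CLOSED; the v4 composition landed as `Mirror.avgFaceBeyondPrior_iff_realFaceHard_of`,
Theorems/ArithStatLadderAvgFaceBeyondPriorMirrorTransport.lean). v4 left three stubs: `stub_scholzLeft` (Scholz's
`r ≤ s`, = `Scholz1932_reflection.left`, Literature named fact in flight), `stub_threeDvdImpCube` (unit criterion (ii),
= `ScholzHecke_unitCubeCriterion.three_dvd_imp_cube`, in flight: KummerDescent / KummerTower / UnitCubeOfCongruence /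
UnitCubeOfUnramified / CubeClassesOfTrivialThreeTorsion landed 09:13–11:04Z) and the hypothesis-type `stub_realFaceHard`.

v5 RESHAPES stub 1 to exactly what the composition consumes: not the inequality `#Cl₃(D⁺) ≤ #Cl₃(−d)` but its
rank-one shadow **`#Cl₃(D⁺) ≠ 1 → 3 ∣ h(−d)`** (`stub_mirrorTorsionImpThreeDvd`). It is WEAKER than v4's stub (so the
composition is unchanged and the day `Scholz1932_reflection_holds` lands it still closes by one line:
`Scholz1932_reflection.left` + Cauchy, `three_dvd_classNumber_iff_one_lt_quadFieldThreeTorsion`), and it is provable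
NOW from the tree's class field theory without any counting of extensions: an index-`3` subgroup of `Cl(ℚ(√D⁺))`
(`card_index_three_eq_quadFieldThreeTorsion_sub_one_div_two`) has a cubic class field `E` (PROVED Artin reciprocity:
`exists_isCubicClassField`), normal over `ℚ` with `Gal(ℚ(√D⁺)/ℚ)` acting by inversion
(`CubicClassFieldNormal`); over `M = ℚ(√D⁺, ζ₃)` it is Kummer, `E·M = M(∛θ)` (`ScholzHecke.exists_kummer_generator`),
and the descent `ScholzHecke.exists_fixed_kummer_datum` puts `θ` (a non-cube) in the mirror field `ℚ(√−3D⁺) = ℚ(√−d)`;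
`E·M/M` unramified gives `3 ∣ v(θ)` for every finite place of `ℚ(√−d)` (`three_dvd_log_valuation_of_eq_cube`), so
`(θ) = 𝔟³` with `𝔟` non-principal because the units `±1` (`±1, ±i` at `d = 4`) of `ℚ(√−d)`, `d ≠ 3`, are cubes:
`[𝔟]` has order `3`, i.e. `3 ∣ h(−d)`. (The degenerate `d = 3` has `D⁺ = 1`, `quadFieldThreeTorsion 1 = 1`.)

v6 (13:29Z): stub 1 LANDED — `Mirror.stub_mirrorTorsionImpThreeDvd`, p105755 (wave-1 worker of lead c2; 206 lines:
`exists_isCubicClassField` + `CubicClassFieldNormal` + `NumberFields.exists_kummer_generator` over the mirror field of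
`ScholzMirrorField.lean` + `exists_subgroup_monoidHom_classGroup_of_dvd_valuation` + units `±1` are cubes), imported below.

v7 (13:53Z): stub 3 LANDED — `Mirror.stub_threeDvdImpCube`, p107075 (wave-2 worker of lead c2; 383 lines: cubic class field
of `ℚ(√−d)` → `exists_kummer_generator` in the real mirror field → `ScholzHecke.exists_cube_root_unit` (`#Cl₃(D⁺) = 1`, the
`IsMirrorFundUnit` unit is not a cube of a unit) → `ScholzHecke.unitCubeAtThree_of_isUnramifiedAt` (Hecke Satz 119)), imported
below through its Literature re-homing `ScholzHecke.three_dvd_imp_cube` (the named fact is DISCHARGED: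
`ScholzHecke_unitCubeCriterion_holds`, p107486, 14:03Z). THE SKELETON IS NOW CLOSED MODULO THE SINGLE HYPOTHESIS-TYPE STUB
`stub_realFaceHard`:
`AvgFaceBeyondPrior_of : stub_realFaceHard → AvgFaceBeyondPrior` and conversely `realFaceHard_of_crux'`, i.e.
crux ⟺ stub 4 UNCONDITIONALLY (`avgFaceBeyondPrior_iff_realFaceHard'` below).

Registered stubs of v7 (names keyed for the skeleton audit):
* `stub_mirrorTorsionImpThreeDvd` — CLOSED (p105755; Theorems/ArithStatLadderAvgFaceBeyondPriorMirrorTorsionImpThreeDvd.lean);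
* `stub_cubeImpThreeDvd` — unit criterion (i) (CLOSED: `ScholzHecke.cube_imp_three_dvd`);
* `stub_threeDvdImpCube` — unit criterion (ii) (CLOSED, p107075; Theorems/ArithStatLadderAvgFaceBeyondPriorThreeDvdImpCube.lean;
  = `ScholzHecke.three_dvd_imp_cube`, Literature/…/ScholzHeckeUnitCriterionHolds.lean, p107486);
* `stub_realFaceHard`    — HYPOTHESIS-TYPE, byte-identical to v3/v4: the real face
  `{d : −d fund., d ≠ 3, UnitCubeAtThree d ∨ #Cl₃(D⁺) ≠ 1}` is `Heur_{1/3}BPP`-hard on `U`. EQUIVALENT to the crux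
  given stubs 1–3 (`AvgFaceBeyondPrior_of` / `realFaceHard_of_crux'`); separation-strength
  (crux ⇒ `IQ3 ∉ BPP`, `Negative.avgFace_imp_not_mem_BPP`). Not staffed; refuters first.

Composition `AvgFaceBeyondPrior_of : stub_realFaceHard → AvgFaceBeyondPrior` (PROVED; exact transport `IQ3 = RealFace`;
the closed stubs 1, (i), (ii) are used inside as theorems).

## Disproof used (`Cruxes/AvgFaceBeyondPrior/Disproof.lean` v5; landed `Negative/*`, `DeltaCeiling`)
* `avgFaceBeyondPrior_false_without_PPT` — PPT occurs only inside `stub_realFaceHard`.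
* `avgFaceBeyondPrior_false_without_conditioning` — every set is cut by the literal fundamental predicate; `U = Negative.ens`.
* `avgFace_imp_exists_level_ge` (crux ⇒ density of `3 ∣ h(−d)` exceeds `1/3` at arbitrarily late levels; OPEN in print)
  and `DeltaCeiling.not_strongFace_of_dh` (given Davenport–Heilbronn the `δ > 1/2` faces are false): the crux's
  constant lives in `[1/3, 1/2]`; stub 4 inherits both (it IS the crux given stubs 1–3).
* `not_avgFace_of_mirrorAgreement` (Negative/Transfer, p86263) = v3's `stub_heurTransfer` verbatim — imported.
* No `-- Targets` theorem kills any v5 stub: stubs 1–3 are printed theorems certified as typed on all 159 375 fundamental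
  `−d < 2^19` (kit j012491, j014591), stub 4 is the crux in mirror coordinates.
-/

noncomputable section

open scoped Classical
open Filter

-- skeleton checked standalone (module `_stdin`): the summit's doubled path component is not exempted there
set_option linter.dupNamespace false

namespace Summit.QuantumAdvantage.QuantumAdvantage.Theorems.AvgFaceBeyondPrior.Mirror

open _root_.Computability
open Literature.Computability.Complexity Literature.Computability.MetaComplexity
  Literature.Computability.Cryptography Literature.NumberTheory.QuadraticFields
open Summit.QuantumAdvantage.QuantumAdvantage.Theses.ArithStatLadder
open Summit.QuantumAdvantage.QuantumAdvantage.Theorems.AvgFaceBeyondPrior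

/-! ### Instance hygiene
`ThreeTorsionMeanLocalAtThree` (→ `ThreeTorsionMean`) brings the computable
`instDecidablePredSquarefreeInt`; the route file and `Negative/*` decide `Squarefree (−d)` classically. Every finset below is
`Negative.fundBlock n` BY NAME, so no literal `Finset.filter` copy of the route's block is elaborated here; the computable
instance is nevertheless switched off so that any incidental `Finset.filter` on the fundamental predicate matches the route's. -/
attribute [-instance] Literature.NumberTheory.QuadraticFields.instDecidablePredSquarefreeInt

/-! ### Vocabulary (aliases only; the Literature copies `mirrorRadicand`, `IsMirrorFundUnit`, `unitPow8`,
`UnitCubeAtThree` of `ScholzHeckeUnitCriterion.lean` are used BY NAME) -/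

/-- `−d` is a (negative) fundamental discriminant — the route's LITERAL predicate. [folklore] -/
abbrev IsNegFund (d : ℕ) : Prop :=
  (((-(d:ℤ)) % 4 = 1 ∧ Squarefree (-(d:ℤ)) ∧ (-(d:ℤ)) ≠ 1) ∨
    (4 ∣ (-(d:ℤ)) ∧ ((-(d:ℤ)) / 4 % 4 = 2 ∨ (-(d:ℤ)) / 4 % 4 = 3) ∧ Squarefree ((-(d:ℤ)) / 4)))

/-- The mirror discriminant `D⁺ = disc ℚ(√3d)`: `d/3` if `3 ∣ d`, `3d` otherwise (literal, as in the route items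
`UnitCubeCriterion` / `MirrorRankRare` and the Literature facts). [cite: Scholz1932, pp. 201–203] -/
abbrev mirrorDisc (d : ℕ) : ℤ := if 3 ∣ d then ((d / 3 : ℕ) : ℤ) else 3 * (d : ℤ)

/-- The real face of `IQ3`: `−d` fundamental, `d ≠ 3`, and (the mirror unit is a cube at `3` OR `ℚ(√3d)` has a
`3`-torsion ideal class) — literal set of the registered `stub_realFaceHard`. [cite: Scholz1932, pp. 201–203] -/
abbrev realFaceSet : Set ℕ :=
  {d : ℕ | ((((-(d:ℤ)) % 4 = 1 ∧ Squarefree (-(d:ℤ)) ∧ (-(d:ℤ)) ≠ 1) ∨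
      (4 ∣ (-(d:ℤ)) ∧ ((-(d:ℤ)) / 4 % 4 = 2 ∨ (-(d:ℤ)) / 4 % 4 = 3) ∧ Squarefree ((-(d:ℤ)) / 4))) ∧
    d ≠ 3 ∧ (UnitCubeAtThree d ∨
      quadFieldThreeTorsion (if 3 ∣ d then ((d / 3 : ℕ) : ℤ) else 3 * (d : ℤ)) ≠ 1))}

/-- `h(−3) = 1`, so `3 ∤ h(−3)`: the degenerate point `d = 3` (`D⁺ = 1`) lies outside `IQ3`. [folklore] -/
theorem not_three_dvd_classNumber_neg_three' : ¬ (3 ∣ BinaryQuadraticForm.classNumber (-3)) := by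
  decide

/-! ### The registered stubs (v5) -/

/-- STUB 1 (CLOSED in v6 — landed as `Mirror.stub_mirrorTorsionImpThreeDvd`, p105755): for `−d` fundamental, a nontrivial
`3`-torsion ideal class of the real mirror field `ℚ(√3d)` (discriminant `D⁺ = d/3` or `3d`) forces `3 ∣ h(−d)` — the
rank-one shadow of Scholz's `r ≤ s`, from the tree's Artin reciprocity and Scholz's Kummer generator.
[cite: Washington1997, Thm 10.10 (proof)] -/
example :
    ∀ d : ℕ, ((((-(d:ℤ)) % 4 = 1 ∧ Squarefree (-(d:ℤ)) ∧ (-(d:ℤ)) ≠ 1) ∨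
        (4 ∣ (-(d:ℤ)) ∧ ((-(d:ℤ)) / 4 % 4 = 2 ∨ (-(d:ℤ)) / 4 % 4 = 3) ∧ Squarefree ((-(d:ℤ)) / 4)))) →
      quadFieldThreeTorsion (if 3 ∣ d then ((d / 3 : ℕ) : ℤ) else 3 * (d : ℤ)) ≠ 1 →
        3 ∣ BinaryQuadraticForm.classNumber (-(d:ℤ)) :=
  stub_mirrorTorsionImpThreeDvd

/-- STUB 2 (CLOSED — direction (i) of the Scholz–Hecke unit criterion, PROVED in the tree as
`ScholzHecke.cube_imp_three_dvd`, p92320): for `−d` fundamental, `d ≠ 3`, if the fundamental unit of `ℚ(√3d)` is a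
cube at `3` then `3 ∣ h(−d)`. [cite: Washington1997, Thm 10.10 (proof)] -/
theorem stub_cubeImpThreeDvd :
    ∀ d : ℕ, ((((-(d:ℤ)) % 4 = 1 ∧ Squarefree (-(d:ℤ)) ∧ (-(d:ℤ)) ≠ 1) ∨
        (4 ∣ (-(d:ℤ)) ∧ ((-(d:ℤ)) / 4 % 4 = 2 ∨ (-(d:ℤ)) / 4 % 4 = 3) ∧ Squarefree ((-(d:ℤ)) / 4)))) →
      d ≠ 3 → UnitCubeAtThree d → 3 ∣ BinaryQuadraticForm.classNumber (-(d:ℤ)) :=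
  fun _ hd h3 hu => ScholzHecke.cube_imp_three_dvd hd h3 hu

/-- STUB 3 (CLOSED in v7 — landed as `Mirror.stub_threeDvdImpCube`, p107075; direction (ii) of the Scholz–Hecke unit
criterion): for `−d` fundamental, `d ≠ 3`, `#Cl₃(D⁺) = 1` and `3 ∣ h(−d)` force `UnitCubeAtThree d`.
[cite: Washington1997, Thm 10.10 (proof)] -/
example :
    ∀ d : ℕ, ((((-(d:ℤ)) % 4 = 1 ∧ Squarefree (-(d:ℤ)) ∧ (-(d:ℤ)) ≠ 1) ∨
        (4 ∣ (-(d:ℤ)) ∧ ((-(d:ℤ)) / 4 % 4 = 2 ∨ (-(d:ℤ)) / 4 % 4 = 3) ∧ Squarefree ((-(d:ℤ)) / 4)))) →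
      d ≠ 3 → quadFieldThreeTorsion (if 3 ∣ d then ((d / 3 : ℕ) : ℤ) else 3 * (d : ℤ)) = 1 →
        3 ∣ BinaryQuadraticForm.classNumber (-(d:ℤ)) → UnitCubeAtThree d :=
  fun _ hd h3 ht hh => ScholzHecke.three_dvd_imp_cube hd h3 ht hh

/-- STUB 4 (HYPOTHESIS-TYPE — the transfer target; separation-strength `≥ NP ⊄ BPP`; not staffed; refuters first) —
**the real face is `Heur_{1/3}BPP`-hard**: no PPT algorithm is confidently correct on `≥ 2/3` of the `U_n`-mass, for
every `n`, about membership in `RealFace = {d : −d fund., d ≠ 3, UnitCubeAtThree d ∨ #Cl₃(D⁺) ≠ 1}`, on the route's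
literal ensemble `Negative.ens = U`. Equivalent to the crux given stubs 1–3 (`AvgFaceBeyondPrior_of`,
`realFaceHard_of_crux`). Byte-identical to lead 0's registration. -/
theorem stub_realFaceHard :
    (⟨encodingNatBool.toLanguage {d : ℕ | ((((-(d:ℤ)) % 4 = 1 ∧ Squarefree (-(d:ℤ)) ∧ (-(d:ℤ)) ≠ 1) ∨
        (4 ∣ (-(d:ℤ)) ∧ ((-(d:ℤ)) / 4 % 4 = 2 ∨ (-(d:ℤ)) / 4 % 4 = 3) ∧ Squarefree ((-(d:ℤ)) / 4))) ∧
        d ≠ 3 ∧ (UnitCubeAtThree d ∨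
          quadFieldThreeTorsion (if 3 ∣ d then ((d / 3 : ℕ) : ℤ) else 3 * (d : ℤ)) ≠ 1))},
      Negative.ens⟩ : DistProblem) ∉ HeurDeltaBPP (fun _ => (1 : ℝ) / 3) := by
  sorry

/-! ### The five stubs of v3 that LANDED (closed by the landed declarations, same names) -/

/-- STUB 5 (CLOSED, p87687) — 3-torsion is rare in the mirror family, modulo the two Bhargava–Varma cite facts.
[cite: BhargavaVarma2016, Cor. 4] -/
example :
    bv_threeTorsion_mean_localAtThree → bv_count_posFundDiscrs_localAtThree →
    ∀ ε : ℝ, 0 < ε → ∀ᶠ n : ℕ in atTop,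
      ((((Negative.fundBlock n).filter fun d : ℕ =>
          quadFieldThreeTorsion (if 3 ∣ d then ((d / 3 : ℕ) : ℤ) else 3 * (d : ℤ)) ≠ 1).card : ℝ))
        ≤ (1 / 6 + ε) * ((Negative.fundBlock n).card : ℝ) :=
  stub_mirrorRankRare

/-- STUB 6 (CLOSED, p87995) — the mirror transfer. [cite: BogdanovTrevisan2006, §2.3] -/
example :
    ∀ T : Set ℕ,
      (∀ ε : ℝ, 0 < ε → ∀ᶠ n : ℕ in atTop,
        ((((Negative.fundBlock n).filter fun d : ℕ =>
            ¬ (3 ∣ BinaryQuadraticForm.classNumber (-(d:ℤ)) ↔ d ∈ T)).card : ℝ))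
          ≤ (1 / 6 + ε) * ((Negative.fundBlock n).card : ℝ)) →
      encodingNatBool.toLanguage T ∈ BPP →
      ¬ Summit.QuantumAdvantage.QuantumAdvantage.Theses.ArithStatLadder.AvgFaceBeyondPrior :=
  stub_heurTransfer

/-- STUBS 7–9 (CLOSED, p85730 / p91280 / p86441 + route item UnitCubeMemBQP p90624) — the unit language is in `BQP`,
GRH-free. [cite: Hallgren2007, Thm 1.1] -/
example : Summit.QuantumAdvantage.QuantumAdvantage.Theses.ArithStatLadder.UnitCubeMemBQP :=
  Summit.QuantumAdvantage.QuantumAdvantage.Theorems.ArithStatLadder.UnitCubeMemBQP_proof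

/-! ### Name-keyed aliases of the OPEN/registered stub statements (the skeleton audit admits a hypothesis of the
composition only if its head constant is a registered obligation or is named like a declared stub) -/
namespace Registered

/-- Alias of stub 4's statement keyed by the stub name. -/
abbrev stub_realFaceHard : Prop :=
  (⟨encodingNatBool.toLanguage {d : ℕ | ((((-(d:ℤ)) % 4 = 1 ∧ Squarefree (-(d:ℤ)) ∧ (-(d:ℤ)) ≠ 1) ∨
      (4 ∣ (-(d:ℤ)) ∧ ((-(d:ℤ)) / 4 % 4 = 2 ∨ (-(d:ℤ)) / 4 % 4 = 3) ∧ Squarefree ((-(d:ℤ)) / 4))) ∧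
      d ≠ 3 ∧ (UnitCubeAtThree d ∨
        quadFieldThreeTorsion (if 3 ∣ d then ((d / 3 : ℕ) : ℤ) else 3 * (d : ℤ)) ≠ 1))},
    Negative.ens⟩ : DistProblem) ∉ HeurDeltaBPP (fun _ => (1 : ℝ) / 3)

end Registered

/-! ### Glue, PROVED: the exact transport `IQ3 = RealFace` -/

/-- **`IQ3 = RealFace` pointwise** (the closed stubs 1–3, now theorems): `d ∈ IQ3` (the landed literal `Negative.iq3Set`) iff `−d` is
fundamental, `d ≠ 3`, and the mirror unit is a cube at `3` or `#Cl₃(D⁺) ≠ 1`. [folklore] -/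
theorem mem_iq3Set_iff_mem_realFaceSet' (d : ℕ) :
    d ∈ Negative.iq3Set ↔ d ∈ realFaceSet := by
  simp only [Negative.iq3Set, realFaceSet, Set.mem_setOf_eq]
  constructor
  · rintro ⟨hf, hdvd⟩
    have hne : d ≠ 3 := by
      rintro rfl
      exact not_three_dvd_classNumber_neg_three' hdvd
    refine ⟨hf, hne, ?_⟩
    by_cases ht : quadFieldThreeTorsion (mirrorDisc d) = 1
    · exact Or.inl (ScholzHecke.three_dvd_imp_cube hf hne ht hdvd)
    · exact Or.inr ht
  · rintro ⟨hf, hne, hc | ht⟩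
    · exact ⟨hf, stub_cubeImpThreeDvd d hf hne hc⟩
    · exact ⟨hf, stub_mirrorTorsionImpThreeDvd d hf ht⟩

/-- Hence the crux's distributional problem `Negative.Q = (IQ3, U)` IS the real-face problem on `U`. [folklore] -/
theorem q_eq_realFaceProblem' :
    Negative.Q = (⟨encodingNatBool.toLanguage realFaceSet, Negative.ens⟩ : DistProblem) := by
  have hset : Negative.iq3Set = realFaceSet := Set.ext mem_iq3Set_iff_mem_realFaceSet'
  show (⟨encodingNatBool.toLanguage Negative.iq3Set, Negative.ens⟩ : DistProblem) = _
  rw [hset]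

/-! ### The composition: stubs 1–4 imply the crux, BY NAME -/

/-- **`AvgFaceBeyondPrior` from the registered stubs** (no `sorry` outside the stubs): the crux is
`Negative.Q ∉ Heur_{1/3}BPP` (`Negative.avgFace_iff_Q`, `Iff.rfl`); by the mirror-torsion implication (stub 1) and the unit criterion
(stubs 2–3) `Negative.Q` IS the real-face problem (`q_eq_realFaceProblem'`); stub 4 is its hardness. -/
theorem AvgFaceBeyondPrior_of (h4 : Registered.stub_realFaceHard) :
    Summit.QuantumAdvantage.QuantumAdvantage.Theses.ArithStatLadder.AvgFaceBeyondPrior := by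
  rw [Negative.avgFace_iff_Q, q_eq_realFaceProblem']
  exact h4

/-- Wiring check: the registered stubs feed `AvgFaceBeyondPrior_of` as stated. -/
example : Summit.QuantumAdvantage.QuantumAdvantage.Theses.ArithStatLadder.AvgFaceBeyondPrior :=
  AvgFaceBeyondPrior_of stub_realFaceHard

/-- Conversely the crux gives stub 4 (so stub 4 is EXACTLY as strong as the crux, given stubs 1–3). [folklore] -/
theorem realFaceHard_of_crux'
    (hc : Summit.QuantumAdvantage.QuantumAdvantage.Theses.ArithStatLadder.AvgFaceBeyondPrior) :
    Registered.stub_realFaceHard := by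
  rw [Negative.avgFace_iff_Q, q_eq_realFaceProblem'] at hc
  exact hc

/-- **crux ⟺ stub 4, unconditionally** (v7: stubs 1–3 are theorems): `AvgFaceBeyondPrior` holds iff the real-face
problem is `Heur_{1/3}BPP`-hard. [cite: BogdanovTrevisan2006, §2.3] -/
theorem avgFaceBeyondPrior_iff_realFaceHard' :
    Summit.QuantumAdvantage.QuantumAdvantage.Theses.ArithStatLadder.AvgFaceBeyondPrior ↔ Registered.stub_realFaceHard :=
  ⟨realFaceHard_of_crux', AvgFaceBeyondPrior_of⟩

/-- **The arithmetic shadow of stub 4, typed** (landed `Negative.avgFace_imp_exists_level` transported through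
stubs 1–3): the crux forces SOME level at which more than a third of the block lies in the real face
`{UnitCubeAtThree ∨ #Cl₃(D⁺) ≠ 1}` (CL value `0.2800 + 0.1599 = 0.4399`, observed `0.4004` at `n = 19`; the
`∀ N ∃ n ≥ N` sharpening is `Negative.avgFace_imp_exists_level_ge`, Often file). [cite: CohenLenstra1984, §9 (C2)] -/
theorem crux_imp_exists_realFace_level'
    (hc : Summit.QuantumAdvantage.QuantumAdvantage.Theses.ArithStatLadder.AvgFaceBeyondPrior) :
    ∃ n, (Negative.fundBlock n).Nonempty ∧
      ((Negative.fundBlock n).card : ℝ) <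
        3 * ((Negative.fundBlock n).filter fun d : ℕ => d ∈ realFaceSet).card := by
  obtain ⟨n, hne, hlt⟩ := Negative.avgFace_imp_exists_level hc
  refine ⟨n, hne, ?_⟩
  have hfilter : ((Negative.fundBlock n).filter fun d : ℕ => 3 ∣ BinaryQuadraticForm.classNumber (-(d:ℤ))) =
      (Negative.fundBlock n).filter fun d : ℕ => d ∈ realFaceSet := by
    refine Finset.filter_congr fun d hd => ?_
    have hf : IsNegFund d := (Finset.mem_filter.1 hd).2
    rw [← mem_iq3Set_iff_mem_realFaceSet' d]
    exact ⟨fun hdvd => ⟨hf, hdvd⟩, fun h => h.2⟩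
  rw [← hfilter]
  exact hlt

/-! ### The assembly side (landed): with the route items the crux ALONE decides the summit, GRH-free modulo the two
printed debts `UnitCubeCriterion` (= stubs 2–3) and `MirrorRankRare` (Bhargava–Varma) -/

/-- closes′ (landed pieces only): `UnitCubeCriterion → MirrorRankRare → AvgFaceBeyondPrior → QuantumAdvantage`.
[folklore] -/
theorem quantumAdvantage_of_crux'
    (hU : Summit.QuantumAdvantage.QuantumAdvantage.Theses.ArithStatLadder.UnitCubeCriterion)
    (hR : Summit.QuantumAdvantage.QuantumAdvantage.Theses.ArithStatLadder.MirrorRankRare)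
    (hc : Summit.QuantumAdvantage.QuantumAdvantage.Theses.ArithStatLadder.AvgFaceBeyondPrior) :
    _root_.QuantumAdvantage :=
  Summit.QuantumAdvantage.QuantumAdvantage.Theorems.ArithStatLadder.MirrorAssembly_proof hU hR
    Summit.QuantumAdvantage.QuantumAdvantage.Theorems.ArithStatLadder.UnitCubeMemBQP_proof
    Summit.QuantumAdvantage.QuantumAdvantage.Theorems.ArithStatLadder.MirrorHeurTransfer_proof hc

end Summit.QuantumAdvantage.QuantumAdvantage.Theorems.AvgFaceBeyondPrior.Mirror

end
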